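import Summits.QuantumFields.YangMills.Theorems.UnitScaleTiltProp7Row74AtMemberT3
import Summits.QuantumFields.YangMills.Theorems.UnitScaleTiltProp7ActionGradCurrentT3
import Summits.QuantumFields.YangMills.Theorems.UnitScaleTiltProp7SectET3WChartConjT3
import Summits.QuantumFields.YangMills.Theorems.UnitScaleTiltProp7SectET3DeltaOneT3JTermRowsRegPr
import Literature.MathematicalPhysics.QuantumFieldTheory.Balaban1983to89.B11Eq78QuadLetterModulus
import HarnessLib

/-!
# Route `UnitScaleTilt`, crux «MinimiserStabilityRegPr» (stmt-QuantumFields-19200, stub EX `stub_existenceMinimalOrbit`, route (α)) — «H79-MEMBER»: **THE ROW (r79) OF THE LATTICE (84)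
# AT THE T³ MEMBER** — [Balaban1985Variational] (78)–(79) «Δ₁ = Δ_π − Δ_π⁽²⁾, ½⟨A′, Δ_π⁽²⁾A′⟩ = ⟨HC⁽²⁾(A′), J⟩» ∕ [Balaban1985BackgroundPropagators] (3.127)–(3.128), in the currency of lit
# `B11Eq81ExpansionZpow.hasDerivAt_actionZ_chartRay_real`'s hypothesis `h79 : ∀ Y, P Y → pair27 τ (Δ₁ Y) (flat115 Y) = pair27 τ (Δπ Y) (flat115 Y) − 2·pair27 τ J (flat115 (H (quadPart C Y)))`,
# AT THE LETTERS OF RECORD TODAY (`Δ₁ := DeltaOneJ`, `Δ_π := DeltaPiSlot`, `H̃ := H1f …Δ_π… U₀`, `C̃ := (−I)•CmapTwS U₀ (κ_f • ι·)`), for `U₀ ∈ 𝔘_k(ε₀)` in the windows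

Cell `ym3-torus` (HUMAN RULING D-0037, YM ladder rung R3 — YM₃ on T³, NOT d = 4, NOT Clay; YM gap NOT proved), width seat `ym3-torus-px21` gen 2 (explicit-unit helper; lineage `hCrit93′`:
✓`Prop7Crit93OfEq111`, ✓`Prop7ActionGradCurrent`, ✓`Prop7ActionLatticeTransport`, ✓`Prop7Crit93AtMemberOfRow84`, ✓`Prop7Row74AtMember`, ✓`Prop7ChartRayContinuity`); EX namer ★`ym-ust-19200-w2` g6
2026-08-28T20:48:46Z: «`h79`-member at `DeltaOneJᴾ` (S; waits for P0's Δ₁ twins) — type against `DeltaOneJ` today».  THEOREMS ONLY (0 `def`, 0 `sorry`); `--supports stmt-QuantumFields-19200 --as helper`,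
count-neutral; NO claim on crux ∕ stub ∕ registry.

THE PRINT.  [Balaban1985Variational] p. 290: «⟨HD(A′), J⟩ = ⟨HC⁽²⁾(A′), J⟩ + ⟨HD₃(A′), J⟩ (78) … Δ₁ = Δ_π − Δ_π⁽²⁾, where Δ_π⁽²⁾ is defined by ½⟨A′, Δ_π⁽²⁾A′⟩ = ⟨HC⁽²⁾(A′), J⟩ (79)»;
[Balaban1985BackgroundPropagators] p. 421 (3.127): «½⟨A, ΔA⟩ − ⟨HC⁽²⁾(A), J⟩ … defines G₁» (3.128).  In the tree `Δ₁` of record is `DeltaOneJ = Pᵀ(Δ^η + T_J)P` with the J-term `T_J` read from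
`t_J[X, Y] = −actionGrad (H46 (avgHess X Y))` (`avgHess = D²(log U̿^{twS})(0) = 2C⁽²⁾` polarised, exponent units); the display's remainder is `C̃ A′ = (−I)•CmapTwS U₀ (κ_f • ιA′)` (A-units,
`κ_f = (η:ℂ)·I`), whose quadratic letter is `C̃⁽²⁾(Y) = ½D²C̃(0)[Y, Y] = (I·η²∕2)•avgHess (ιY) (ιY)` (§1), and `κ_f • ι∘H̃ = H46∘(I•·)` (✓`smul_iota_H1f_eq_H46_smul`, (G22)).  So on Landau Hermitian
`ιY` both sides of (r79) reduce to `η³c₀⁻¹⟪v, Δ^ηv⟫ − 2η·t_J[ιY, ιY]`, the one non-formal input being the REALITY `t_J[ιY, ιY] ∈ ℝ` (✓`tjForm_star` at `U₀ ∈ 𝔘_k(ε₀)`: ✓`QTwS_star_comm_of_regPr`,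
Schwarz ✓`fderiv_fderiv_logChartTwS_symm_of_regPr`, ✓`fderiv_fderiv_logChartTwS_star_of_traceless`, centre-flatness ✓`avgHess_apply_smul_one_eq_zero_of_regPr`) and the analyticity of the
log-chart on `B(0, e·η)` (✓`analyticOnNhd_logChartTwS`) for the second derivative of `C̃`.

WHAT IS PROVED (member `F`, `K n`, `h : n ≤ K`; `U₀ ∈ 𝔘_k(ε₀)` with `10⁹L²e ≤ 1`, `10¹²L³ε₀ ≤ 1`; ns `…Theorems.Prop7Row79AtMember`):
* §1 ★★`fderiv_fderiv_CmapTwS_eq_avgHess` (`D²C(U₀, ·)(0) = avgHess U₀` on the analyticity ball) and ★★`quadPart_Ctilde_eq` (`quadPart C̃ Y = (I·η²∕2) • avgHess U₀ (ιY) (ιY)`).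
* §2 `tjForm_rows_of_regPr` (the four rows `hQ hAs hAr hAc` of ✓`tjForm_star` at `𝔘_k(ε₀)`), ★`tjForm_self_real_of_star_eq` (`conj t_J[X, X] = t_J[X, X]` for `Xᴴ = X`),
  ★★`inner_DeltaOneJ_sub_inner_DeltaPi_of_landau` (`⟪v, Δ₁v⟫ − ⟪v, Δ_πv⟫ = tjSesq v v` for Landau `v`, at `𝔘_k(ε₀)`), ★`pair27_Jcur_iota_H1f_eq` (`κ_f·pair27 tr J (flat115 (H̃ X′)) = (2I·η³… )` — the `J`-pairing of an
  `H̃`-image through `actionGrad ∘ H46`).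
* §3 ★★★**`pair27_DeltaOneJ_eq_of_landau`** — (r79) AT THE MEMBER for Landau Hermitian `ιY`; and the member text ★★`h79_member_DeltaOneJ : ∀ Y, (IsLandauPrintS … ιY ∧ ∀ b, star (ιY b) = ιY b) → …`
  (lit's `h79` with `P Y := Landau ∧ Hermitian`, `Δ₁ := currentCLM … (DeltaOneJ … U₀)`, `Δπ := currentCLM … (DeltaPiSlot … U₀)`, `H := H1f …Δ_π… U₀`, `C := C̃`, `J := Jcur (bgOfCfg F K U₀)`).
HONEST SCOPE.  Calculus and linear algebra over landed letters at the NON-pinv letters of today (the `DeltaOnePJ ∕ DeltaPiSlotP ∕ H46P` twin is a re-lettering once P0 carries `DeltaOnePJ`); the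
regime `U₀ ∈ 𝔘_k(ε₀)` + windows displayed; no estimate; not a proof of any stub; nothing continuum ∕ OS ∕ mass-gap ∕ Clay.

References: T. Bałaban, CMP **102** (1985) 277–309 [Balaban1985Variational] ((44) p.285, (56) p.286, (78)–(79), (84) p.290, (110)–(111) p.294); CMP **99** (1985) 389–434
[Balaban1985BackgroundPropagators] ((3.11)–(3.14) pp.392–393, (3.119) p.419, (3.126)–(3.128) pp.420–421).
-/

set_option autoImplicit false

noncomputable section

open scoped InnerProductSpace ComplexConjugate Matrix.Norms.L2Operator BigOperators Topology
open Complex (I)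
open Filter Metric

namespace Summit.QuantumFields.YangMills.Theorems.Prop7Row79AtMember

open Literature.MathematicalPhysics.QuantumFieldTheory.Balaban1983to89
open Literature.MathematicalPhysics.QuantumFieldTheory.Balaban1983to89.T3ContinuumYM3Torus
open T3SectALandauChart (eta eta_pos)
open T3PrintedRegularMinimiser (RegPr)
open B9SectCLatticeCarrier (Bond)
open B11Eq115Space (NegSize Space115 JetSup NegSup)
open B11Eq111FrakG (nabla115)
open B11Eq103H1Complex (SiteL2K BondL2K funEquiv)
open B11Eq98CurrentSlot (Jcur)
open B11Eq90Transpose (pair27)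
open B11Eq90V0primeCurrent (flat115 flat115_apply)
open B11Eq80Current (quadPart)
open B11Eq78QuadLetterModulus (iteratedFDeriv_two_comp_clm_apply)
open B9Eq3119DeltaPiCarrier (currentCLM)
open Summit.QuantumFields.YangMills.Theorems.Prop7SectET3Transport (periodsT3 bondEquiv bgOfCfg)
open Summit.QuantumFields.YangMills.Theorems.Prop7SectET3HilbertLetters (W₂ frobEquiv toL2 DL2 DstarL2)
open Summit.QuantumFields.YangMills.Theorems.Prop7SectET3GaugeProjector (NS RS)
open Summit.QuantumFields.YangMills.Theorems.Prop7SectET3CurvedPropagators (H1f)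
open Summit.QuantumFields.YangMills.Theorems.Prop7SectET3DeltaPi
open Summit.QuantumFields.YangMills.Theorems.Prop7SectET3DeltaOne (actionGrad avgHess avgHess_def tjForm tjForm_apply tjSesq tjSesq_apply TJ TJSlot DeltaOneJ inner_DeltaOneJ tjForm_star
  tjSesq_conj_symm avgHess_apply_smul_one_eq_zero_of_regPr)
open Summit.QuantumFields.YangMills.Theorems.Prop7SymAvgTwSym (logChartTwS QTwS CmapTwS QTwS_star_comm_of_regPr)
open Summit.QuantumFields.YangMills.Theorems.Prop7QTwSHessianReality (fderiv_fderiv_logChartTwS_symm_of_regPr fderiv_fderiv_logChartTwS_star_of_traceless)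
open Summit.QuantumFields.YangMills.Theorems.Prop7CmapTwSymInputs (analyticOnNhd_logChartTwS)
open Summit.QuantumFields.YangMills.Theorems.Prop7SPrint (IsLandauPrintS isLandauPrintS_iff_RS)
open Summit.QuantumFields.YangMills.Theorems.Prop7SectET3WilsonHessian (DeltaEta)
open Summit.QuantumFields.YangMills.Theorems.Prop7Crit93OfEq111 (pair27_eq_inner_toL2 toL2_currentCLM funEquiv_symm_eq_toL2')
open Summit.QuantumFields.YangMills.Theorems.Prop7ActionGradCurrent (actionGrad_eq_inner_toL2_Jcur)
open Summit.QuantumFields.YangMills.Theorems.Prop7SectET3WChartConj (smul_iota_H1f_eq_H46_smul)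
open Summit.QuantumFields.YangMills.Theorems.Prop7Row74AtMember (gaugeCorr_eq_self_of_landau inner_DeltaPi_of_landau)

variable {F : T3Family} {n K : ℕ} {h : n ≤ K} {c₀ cB a : ℝ} [Fact (0 < c₀)] [Fact (0 < cB)]
variable [Fact (0 < (F.L : ℝ))] [Fact (0 < ((F.L : ℝ)⁻¹) ^ (K - n))]

/-! ## §1 The quadratic letter of the display's remainder `C̃`: `C̃⁽²⁾(Y) = (I·η²∕2)•avgHess (ιY) (ιY)` -/

omit [Fact (0 < c₀)] [Fact (0 < cB)] [Fact (0 < (F.L : ℝ))] [Fact (0 < ((F.L : ℝ)⁻¹) ^ (K - n))] in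
/-- ★★ **`D²C(U₀, ·)(0) = avgHess U₀`** — on the analyticity ball `‖X‖ < e·η` of the log-chart (`U₀ ∈ 𝔘_k(ε₀)` in the windows) the remainder `C(U₀, X) = log U̿^{twS}(X) − Q X` has the second
differential of the log-chart at `0` (the linear part drops out). [cite: Balaban1985BackgroundPropagators, (3.14) p.393; Balaban1985Variational, (44) p.285, (56) p.286] -/
theorem fderiv_fderiv_CmapTwS_eq_avgHess {ε₀ e : ℝ} (hε₀ : 0 < ε₀) (he : 0 < e) (hWe : 10 ^ 9 * (F.L : ℝ) ^ 2 * e ≤ 1) (hWε : 10 ^ 12 * (F.L : ℝ) ^ 3 * ε₀ ≤ 1)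
    (U₀ : GaugeField (F.P K) 0 (Matrix.specialUnitaryGroup (Fin 2) ℂ)) (hreg : RegPr F n K ε₀ U₀) :
    fderiv ℂ (fderiv ℂ (CmapTwS F n K h U₀)) 0 = avgHess F n K h U₀ := by
  have hAn := analyticOnNhd_logChartTwS F h hε₀ he hWe hWε U₀ hreg
  have h0 : (0 : PBond (F.P K) 0 → Matrix (Fin 2) (Fin 2) ℂ) ∈ ball (0 : PBond (F.P K) 0 → Matrix (Fin 2) (Fin 2) ℂ) (e * eta F n K) :=
    mem_ball_self (mul_pos he (eta_pos F n K))
  have hball : ball (0 : PBond (F.P K) 0 → Matrix (Fin 2) (Fin 2) ℂ) (e * eta F n K) ∈ 𝓝 (0 : PBond (F.P K) 0 → Matrix (Fin 2) (Fin 2) ℂ) :=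
    isOpen_ball.mem_nhds h0
  -- on the ball, `D C(X) = D(log U̿)(X) − Q`
  have hev : fderiv ℂ (CmapTwS F n K h U₀) =ᶠ[𝓝 0] fun X => fderiv ℂ (logChartTwS F n K h U₀) X - QTwS F n K h U₀ := by
    filter_upwards [hball] with X hX
    have h1 : HasFDerivAt (logChartTwS F n K h U₀) (fderiv ℂ (logChartTwS F n K h U₀) X) X := ((hAn X hX).differentiableAt).hasFDerivAt
    have h2 : HasFDerivAt (fun A => QTwS F n K h U₀ A) (QTwS F n K h U₀) X := (QTwS F n K h U₀).hasFDerivAt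
    exact (h1.sub h2).fderiv
  -- `D(D log U̿)(0) = avgHess`, and the constant `Q` drops out
  have hd2 : HasFDerivAt (fderiv ℂ (logChartTwS F n K h U₀)) (avgHess F n K h U₀) 0 := by
    rw [avgHess_def]
    exact (hAn 0 h0).fderiv.differentiableAt.hasFDerivAt
  exact ((HasFDerivAt.sub_const (𝕜 := ℂ) (QTwS F n K h U₀) hd2).congr_of_eventuallyEq hev).fderiv

/-- ★★ **THE QUADRATIC LETTER OF `C̃`: `quadPart C̃ Y = (I·η²∕2) • avgHess U₀ (ιY) (ιY)`**, `C̃ A′ = (−I)•CmapTwS U₀ (κ_f • ιA′)`, `κ_f = (η:ℂ)·I` (lit `quadPart F Y = ½·D²F(0)[Y, Y]`; chain rule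
through the continuous linear `κ_f • ι`, ✓`iteratedFDeriv_two_comp_clm_apply`; `κ_f² = −η²`). [cite: Balaban1985Variational, (44) p.285, (56) p.286, (78) p.290; Balaban1985BackgroundPropagators, (3.14) p.393] -/
theorem quadPart_Ctilde_eq {ε₀ e : ℝ} (hε₀ : 0 < ε₀) (he : 0 < e) (hWe : 10 ^ 9 * (F.L : ℝ) ^ 2 * e ≤ 1) (hWε : 10 ^ 12 * (F.L : ℝ) ^ 3 * ε₀ ≤ 1)
    (U₀ : GaugeField (F.P K) 0 (Matrix.specialUnitaryGroup (Fin 2) ℂ)) (hreg : RegPr F n K ε₀ U₀)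
    (Y : Space115 (F.L : ℝ) (((F.L : ℝ)⁻¹) ^ (K - n)) (fun _ : Bond 3 (periodsT3 F K) => K - n) (fun _ : Bond 3 (periodsT3 F K) × Fin 3 => K - n)
      (nabla115 (((F.L : ℝ)⁻¹) ^ (K - n)) (bgOfCfg F K U₀))) :
    quadPart (fun A' : Space115 (F.L : ℝ) (((F.L : ℝ)⁻¹) ^ (K - n)) (fun _ : Bond 3 (periodsT3 F K) => K - n)
        (fun _ : Bond 3 (periodsT3 F K) × Fin 3 => K - n) (nabla115 (((F.L : ℝ)⁻¹) ^ (K - n)) (bgOfCfg F K U₀)) =>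
          (-Complex.I) • CmapTwS F n K h U₀ (((((eta F n K : ℝ) : ℂ)) * Complex.I) • fun b : PBond (F.P K) 0 => JetSup.equiv _ _ _ A' (bondEquiv F K b))) Y
      = ((Complex.I * (((eta F n K : ℝ) : ℂ)) ^ 2) / 2) •
          avgHess F n K h U₀ (fun b : PBond (F.P K) 0 => JetSup.equiv _ _ _ Y (bondEquiv F K b)) (fun b : PBond (F.P K) 0 => JetSup.equiv _ _ _ Y (bondEquiv F K b)) := by
  have hAn := analyticOnNhd_logChartTwS F h hε₀ he hWe hWε U₀ hreg
  have hs : 0 < e * eta F n K := mul_pos he (eta_pos F n K)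
  -- the reading `κ_f • ι` as a continuous linear map
  let ιL : Space115 (F.L : ℝ) (((F.L : ℝ)⁻¹) ^ (K - n)) (fun _ : Bond 3 (periodsT3 F K) => K - n) (fun _ : Bond 3 (periodsT3 F K) × Fin 3 => K - n)
      (nabla115 (((F.L : ℝ)⁻¹) ^ (K - n)) (bgOfCfg F K U₀)) →L[ℂ] (PBond (F.P K) 0 → Matrix (Fin 2) (Fin 2) ℂ) :=
    ((((eta F n K : ℝ) : ℂ)) * Complex.I) • ContinuousLinearMap.pi fun b : PBond (F.P K) 0 =>
      (ContinuousLinearMap.proj (R := ℂ) (φ := fun _ : Bond 3 (periodsT3 F K) => Matrix (Fin 2) (Fin 2) ℂ) (bondEquiv F K b)).comp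
        (flat115 : Space115 (F.L : ℝ) (((F.L : ℝ)⁻¹) ^ (K - n)) (fun _ : Bond 3 (periodsT3 F K) => K - n) (fun _ : Bond 3 (periodsT3 F K) × Fin 3 => K - n)
          (nabla115 (((F.L : ℝ)⁻¹) ^ (K - n)) (bgOfCfg F K U₀)) →L[ℂ] (Bond 3 (periodsT3 F K) → Matrix (Fin 2) (Fin 2) ℂ))
  have hιL : ∀ A' : Space115 (F.L : ℝ) (((F.L : ℝ)⁻¹) ^ (K - n)) (fun _ : Bond 3 (periodsT3 F K) => K - n) (fun _ : Bond 3 (periodsT3 F K) × Fin 3 => K - n)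
      (nabla115 (((F.L : ℝ)⁻¹) ^ (K - n)) (bgOfCfg F K U₀)),
      ιL A' = ((((eta F n K : ℝ) : ℂ)) * Complex.I) • fun b : PBond (F.P K) 0 => JetSup.equiv _ _ _ A' (bondEquiv F K b) := fun A' => by
    funext b
    simp only [ιL, FunLike.coe_smul, Pi.smul_apply, ContinuousLinearMap.pi_apply, ContinuousLinearMap.coe_comp, Function.comp_apply,
      ContinuousLinearMap.proj_apply, flat115_apply]
  -- the outer scalar `−I` as a continuous linear map `N`, so that `C̃ = (N ∘ C) ∘ ιL`
  let N : (PBond (F.P n) 0 → Matrix (Fin 2) (Fin 2) ℂ) →L[ℂ] (PBond (F.P n) 0 → Matrix (Fin 2) (Fin 2) ℂ) :=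
    (-Complex.I) • ContinuousLinearMap.id ℂ (PBond (F.P n) 0 → Matrix (Fin 2) (Fin 2) ℂ)
  have hN : ∀ v : PBond (F.P n) 0 → Matrix (Fin 2) (Fin 2) ℂ, N v = (-Complex.I) • v := fun v => rfl
  have hC : (fun A' : Space115 (F.L : ℝ) (((F.L : ℝ)⁻¹) ^ (K - n)) (fun _ : Bond 3 (periodsT3 F K) => K - n)
        (fun _ : Bond 3 (periodsT3 F K) × Fin 3 => K - n) (nabla115 (((F.L : ℝ)⁻¹) ^ (K - n)) (bgOfCfg F K U₀)) =>
          (-Complex.I) • CmapTwS F n K h U₀ (((((eta F n K : ℝ) : ℂ)) * Complex.I) • fun b : PBond (F.P K) 0 => JetSup.equiv _ _ _ A' (bondEquiv F K b)))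
      = fun z => ((N : (PBond (F.P n) 0 → Matrix (Fin 2) (Fin 2) ℂ) → (PBond (F.P n) 0 → Matrix (Fin 2) (Fin 2) ℂ)) ∘ CmapTwS F n K h U₀) (ιL z) := by
    funext A'
    rw [Function.comp_apply, hN, hιL]
  -- `C` is analytic on the ball, `N ∘ C` differentiable there
  have hset : {z : PBond (F.P K) 0 → Matrix (Fin 2) (Fin 2) ℂ | ‖z‖ < e * eta F n K} = ball 0 (e * eta F n K) := by
    ext z
    simp only [Set.mem_setOf_eq, mem_ball, dist_zero_right]
  have hCmap : CmapTwS F n K h U₀ = fun X => logChartTwS F n K h U₀ X - QTwS F n K h U₀ X := rfl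
  have hCdiff : DifferentiableOn ℂ (CmapTwS F n K h U₀) {z : PBond (F.P K) 0 → Matrix (Fin 2) (Fin 2) ℂ | ‖z‖ < e * eta F n K} := by
    rw [hset, hCmap]
    exact hAn.differentiableOn.sub (QTwS F n K h U₀).differentiable.differentiableOn
  have hdiff : DifferentiableOn ℂ (((N : (PBond (F.P n) 0 → Matrix (Fin 2) (Fin 2) ℂ) → (PBond (F.P n) 0 → Matrix (Fin 2) (Fin 2) ℂ)) ∘ CmapTwS F n K h U₀))
      {z : PBond (F.P K) 0 → Matrix (Fin 2) (Fin 2) ℂ | ‖z‖ < e * eta F n K} := N.differentiable.comp_differentiableOn hCdiff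
  have h0 : (0 : PBond (F.P K) 0 → Matrix (Fin 2) (Fin 2) ℂ) ∈ ball (0 : PBond (F.P K) 0 → Matrix (Fin 2) (Fin 2) ℂ) (e * eta F n K) := mem_ball_self hs
  have hA0 : ContDiffAt ℂ 2 (CmapTwS F n K h U₀) 0 := by
    rw [hCmap]; exact ((hAn 0 h0).sub ((QTwS F n K h U₀).analyticAt 0)).contDiffAt
  rw [quadPart, hC, iteratedFDeriv_two_comp_clm_apply hs hdiff ιL Y, N.iteratedFDeriv_comp_left hA0 le_rfl, ContinuousLinearMap.compContinuousMultilinearMap_coe,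
    Function.comp_apply, iteratedFDeriv_two_apply, fderiv_fderiv_CmapTwS_eq_avgHess hε₀ he hWe hWε U₀ hreg, hN]
  simp only [hιL, map_smul, FunLike.coe_smul, Pi.smul_apply, smul_smul]
  congr 1
  have hI : Complex.I * Complex.I = -1 := Complex.I_mul_I
  linear_combination (-(2⁻¹ : ℂ) * Complex.I * (((eta F n K : ℝ) : ℂ)) ^ 2) * hI

/-! ## §2 The J-term rows at `𝔘_k(ε₀)`, `⟪v, Δ₁v⟫ − ⟪v, Δ_πv⟫` on the Landau subspace, and the `J`-pairing of an `H̃`-image -/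

omit [Fact (0 < c₀)] [Fact (0 < cB)] in
/-- **THE FOUR ROWS OF ✓`tjForm_star` AT `U₀ ∈ 𝔘_k(ε₀)`** (`Q`-reality ✓`QTwS_star_comm_of_regPr`, Schwarz ✓`fderiv_fderiv_logChartTwS_symm_of_regPr`, traceless-sector reality
✓`fderiv_fderiv_logChartTwS_star_of_traceless`, centre-flatness ✓`avgHess_apply_smul_one_eq_zero_of_regPr`). [cite: Balaban1985BackgroundPropagators, (3.14) p.393; Balaban1985Variational, (51) p.286] -/
theorem tjForm_rows_of_regPr {ε₀ e : ℝ} (hε₀ : 0 < ε₀) (he : 0 < e) (hWe : 10 ^ 9 * (F.L : ℝ) ^ 2 * e ≤ 1) (hWε : 10 ^ 12 * (F.L : ℝ) ^ 3 * ε₀ ≤ 1)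
    (U₀ : GaugeField (F.P K) 0 (Matrix.specialUnitaryGroup (Fin 2) ℂ)) (hreg : RegPr F n K ε₀ U₀) :
    (∀ A : PBond (F.P K) 0 → Matrix (Fin 2) (Fin 2) ℂ, QTwS F n K h U₀ (star A) = star (QTwS F n K h U₀ A)) ∧
      (∀ X Y : PBond (F.P K) 0 → Matrix (Fin 2) (Fin 2) ℂ, avgHess F n K h U₀ X Y = avgHess F n K h U₀ Y X) ∧
      (∀ X Y : PBond (F.P K) 0 → Matrix (Fin 2) (Fin 2) ℂ, (∀ b, (X b).trace = 0) → (∀ b, (Y b).trace = 0) →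
        ∀ c, avgHess F n K h U₀ (star X) (star Y) c = -star (avgHess F n K h U₀ X Y c)) ∧
      (∀ (X : PBond (F.P K) 0 → Matrix (Fin 2) (Fin 2) ℂ) (z : PBond (F.P K) 0 → ℂ), avgHess F n K h U₀ X (fun b => z b • (1 : Matrix (Fin 2) (Fin 2) ℂ)) = 0) := by
  refine ⟨QTwS_star_comm_of_regPr F h hε₀ he hWe hWε U₀ hreg, fun X Y => ?_, fun X Y hX hY c => ?_, avgHess_apply_smul_one_eq_zero_of_regPr F h hε₀ hWε U₀ hreg⟩
  · rw [avgHess_def]; exact fderiv_fderiv_logChartTwS_symm_of_regPr F h hε₀ he hWe hWε U₀ hreg X Y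
  · rw [avgHess_def]; exact fderiv_fderiv_logChartTwS_star_of_traceless F h hε₀ he hWe hWε U₀ hreg X Y hX hY c

/-- ★ **`t_J[X, X]` IS REAL ON HERMITIAN `X`** at `U₀ ∈ 𝔘_k(ε₀)` (✓`tjForm_star`: `t_J[Xᴴ, Yᴴ] = conj t_J[X, Y]`). [cite: Balaban1985BackgroundPropagators, (3.127) p.421; Balaban1985Variational, (51) p.286] -/
theorem tjForm_self_real_of_star_eq {ε₀ e : ℝ} (hε₀ : 0 < ε₀) (he : 0 < e) (hWe : 10 ^ 9 * (F.L : ℝ) ^ 2 * e ≤ 1) (hWε : 10 ^ 12 * (F.L : ℝ) ^ 3 * ε₀ ≤ 1)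
    (U₀ : GaugeField (F.P K) 0 (Matrix.specialUnitaryGroup (Fin 2) ℂ)) (hreg : RegPr F n K ε₀ U₀) {X : PBond (F.P K) 0 → Matrix (Fin 2) (Fin 2) ℂ} (hX : star X = X) :
    conj (tjForm F n K h c₀ cB a U₀ X X) = tjForm F n K h c₀ cB a U₀ X X := by
  obtain ⟨hQ, hAs, hAr, hAc⟩ := tjForm_rows_of_regPr (h := h) hε₀ he hWe hWε U₀ hreg
  rw [← tjForm_star U₀ hQ hAs hAr hAc, hX]

/-- ★★ **`⟪v, Δ₁ v⟫ − ⟪v, Δ_π v⟫ = tjSesq v v` ON THE LANDAU SUBSPACE** (`P v = v`; `T_J` conjugate-symmetric at `𝔘_k(ε₀)`): (79)∕(3.127)–(3.128) read as «`Δ₁ − Δ_π` is the J-term».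
[cite: Balaban1985Variational, (79) p.290; Balaban1985BackgroundPropagators, (3.119) p.419, (3.127)–(3.128) p.421] -/
theorem inner_DeltaOneJ_sub_inner_DeltaPi_of_landau {ε₀ e : ℝ} (hε₀ : 0 < ε₀) (he : 0 < e) (hWe : 10 ^ 9 * (F.L : ℝ) ^ 2 * e ≤ 1) (hWε : 10 ^ 12 * (F.L : ℝ) ^ 3 * ε₀ ≤ 1)
    (U₀ : GaugeField (F.P K) 0 (Matrix.specialUnitaryGroup (Fin 2) ℂ)) (hreg : RegPr F n K ε₀ U₀) {v : BondL2K ℂ 3 (periodsT3 F K) c₀ W₂}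
    (hv : RS F n K h c₀ cB U₀ (DstarL2 F n K c₀ U₀ v) = 0) :
    ⟪v, DeltaOneJ F n K h c₀ cB a U₀ v⟫_ℂ - ⟪v, DeltaPiSlot F n K h c₀ cB a U₀ v⟫_ℂ = tjSesq F n K h c₀ cB a U₀ v v := by
  obtain ⟨hQ, hAs, hAr, hAc⟩ := tjForm_rows_of_regPr (h := h) hε₀ he hWe hWε U₀ hreg
  rw [inner_DeltaOneJ, DeltaPiSlot_apply, inner_DeltaPi_of_landau U₀ hv hv, gaugeCorr_eq_self_of_landau U₀ hv, tjSesq_conj_symm U₀ hQ hAs hAr hAc, add_sub_cancel_left]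

/-- ★ **THE `J`-PAIRING OF AN `H̃`-IMAGE**: `κ_f · pair27 tr J (flat115 (H̃ X′)) = 2I · actionGrad U₀ (H46 U₀ (I • X′))` — (27) in `L²` letters (✓`pair27_eq_inner_toL2`, ✓`actionGrad_eq_inner_toL2_Jcur`) and the
units identity `κ_f • ι(H̃ X′) = H46 (I • X′)` (✓`smul_iota_H1f_eq_H46_smul`). [cite: Balaban1985Variational, (27) p.282, (45)–(46) p.285, (78) p.290; Balaban1985BackgroundPropagators, (3.11) p.392, (3.126) p.420] -/
theorem pair27_Jcur_iota_H1f_eq (U₀ : GaugeField (F.P K) 0 (Matrix.specialUnitaryGroup (Fin 2) ℂ)) (X' : PBond (F.P n) 0 → Matrix (Fin 2) (Fin 2) ℂ) :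
    ((((eta F n K : ℝ) : ℂ)) * Complex.I) *
        pair27 (LinearMap.toContinuousLinearMap (Matrix.traceLinearMap (Fin 2) ℂ ℂ))
          (Jcur (bgOfCfg F K U₀) : NegSize (F.L : ℝ) (((F.L : ℝ)⁻¹) ^ (K - n)) (fun _ : Bond 3 (periodsT3 F K) => K - n) 3 (Matrix (Fin 2) (Fin 2) ℂ))
          (flat115 (H1f F n K h c₀ cB a (DeltaPiSlot F n K h c₀ cB a) U₀ X'))
      = 2 * Complex.I * actionGrad F K U₀ (H46 F n K h c₀ cB a U₀ (Complex.I • X')) := by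
  have hη : ((((F.L : ℝ)⁻¹) ^ (K - n) : ℝ) : ℂ) = (((eta F n K : ℝ) : ℂ)) := rfl
  have hη0 : (((eta F n K : ℝ) : ℂ)) ≠ 0 := Complex.ofReal_ne_zero.2 (eta_pos F n K).ne'
  have hc : (c₀ : ℂ) ≠ 0 := Complex.ofReal_ne_zero.2 (Fact.out : 0 < c₀).ne'
  have hflat : (fun b : PBond (F.P K) 0 => flat115 (H1f F n K h c₀ cB a (DeltaPiSlot F n K h c₀ cB a) U₀ X') (bondEquiv F K b))
      = fun b : PBond (F.P K) 0 => JetSup.equiv _ _ _ (H1f F n K h c₀ cB a (DeltaPiSlot F n K h c₀ cB a) U₀ X') (bondEquiv F K b) := rfl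
  -- the pairing in `L²` letters and the gradient in `L²` letters share the inner product `X := ⟪toL2 (ιH̃X′)ᴴ, Ĵ⟫`
  have hP := pair27_eq_inner_toL2 (c₀ := c₀) (Jcur (bgOfCfg F K U₀) : NegSize (F.L : ℝ) (((F.L : ℝ)⁻¹) ^ (K - n)) (fun _ : Bond 3 (periodsT3 F K) => K - n) 3 (Matrix (Fin 2) (Fin 2) ℂ))
    (flat115 (H1f F n K h c₀ cB a (DeltaPiSlot F n K h c₀ cB a) U₀ X'))
  rw [hflat, hη] at hP
  -- the gradient along `κ_f • ι(H̃X′) = H46 (I • X′)`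
  have hG := actionGrad_eq_inner_toL2_Jcur (n := n) (c₀ := c₀) U₀ (((((eta F n K : ℝ) : ℂ)) * Complex.I) •
    fun b : PBond (F.P K) 0 => JetSup.equiv _ _ _ (H1f F n K h c₀ cB a (DeltaPiSlot F n K h c₀ cB a) U₀ X') (bondEquiv F K b))
  rw [star_smul, LinearEquiv.map_smul, inner_smul_left, starRingEnd_apply, star_star, smul_iota_H1f_eq_H46_smul, funEquiv_symm_eq_toL2', hη] at hG
  rw [hP, hG]
  have hI : Complex.I * Complex.I = -1 := Complex.I_mul_I
  linear_combination (Complex.I * (((eta F n K : ℝ) : ℂ)) ^ 4 * (c₀ : ℂ)⁻¹ *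
    ⟪toL2 F K c₀ (star fun b : PBond (F.P K) 0 => JetSup.equiv _ _ _ (H1f F n K h c₀ cB a (DeltaPiSlot F n K h c₀ cB a) U₀ X') (bondEquiv F K b)),
      toL2 F K c₀ (fun b : PBond (F.P K) 0 => NegSup.equiv _ _
        (Jcur (bgOfCfg F K U₀) : NegSize (F.L : ℝ) (((F.L : ℝ)⁻¹) ^ (K - n)) (fun _ : Bond 3 (periodsT3 F K) => K - n) 3 (Matrix (Fin 2) (Fin 2) ℂ)) (bondEquiv F K b))⟫_ℂ) * hI

/-! ## §3 ★★★ The row (r79) of the lattice (84) at the member -/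

/-- ★★★ **(r79) AT THE MEMBER**: for `U₀ ∈ 𝔘_k(ε₀)` in the windows and a (115)-field `Y` whose exponent reading `ιY` is Hermitian and Landau,
`pair27 tr (Δ̂₁ Y) (flat115 Y) = pair27 tr (Δ̂_π Y) (flat115 Y) − 2·pair27 tr J (flat115 (H̃ (C̃⁽²⁾(Y))))` with `Δ̂₁ := currentCLM … (DeltaOneJ … U₀)`, `Δ̂_π := currentCLM … (DeltaPiSlot … U₀)`,
`J := Jcur (bgOfCfg F K U₀)`, `H̃ := H1f …Δ_π… U₀`, `C̃ := (−I)•CmapTwS U₀ (κ_f • ι·)` — print's (79) «Δ₁ = Δ_π − Δ_π⁽²⁾, ½⟨A′, Δ_π⁽²⁾A′⟩ = ⟨HC⁽²⁾(A′), J⟩» at the tree's letters.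
[cite: Balaban1985Variational, (78)–(79) p.290, (84) p.290; Balaban1985BackgroundPropagators, (3.127)–(3.128) p.421, (3.119) p.419] -/
theorem pair27_DeltaOneJ_eq_of_landau {ε₀ e : ℝ} (hε₀ : 0 < ε₀) (he : 0 < e) (hWe : 10 ^ 9 * (F.L : ℝ) ^ 2 * e ≤ 1) (hWε : 10 ^ 12 * (F.L : ℝ) ^ 3 * ε₀ ≤ 1)
    (U₀ : GaugeField (F.P K) 0 (Matrix.specialUnitaryGroup (Fin 2) ℂ)) (hreg : RegPr F n K ε₀ U₀)
    (Y : Space115 (F.L : ℝ) (((F.L : ℝ)⁻¹) ^ (K - n)) (fun _ : Bond 3 (periodsT3 F K) => K - n) (fun _ : Bond 3 (periodsT3 F K) × Fin 3 => K - n)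
      (nabla115 (((F.L : ℝ)⁻¹) ^ (K - n)) (bgOfCfg F K U₀)))
    (hR : ∀ b : PBond (F.P K) 0, star (JetSup.equiv _ _ _ Y (bondEquiv F K b)) = JetSup.equiv _ _ _ Y (bondEquiv F K b))
    (hL : IsLandauPrintS F n K h c₀ cB U₀ (fun b : PBond (F.P K) 0 => JetSup.equiv _ _ _ Y (bondEquiv F K b))) :
    pair27 (LinearMap.toContinuousLinearMap (Matrix.traceLinearMap (Fin 2) ℂ ℂ))
        (currentCLM frobEquiv (fun _ : Bond 3 (periodsT3 F K) × Fin 3 => K - n) (nabla115 (((F.L : ℝ)⁻¹) ^ (K - n)) (bgOfCfg F K U₀)) (DeltaOneJ F n K h c₀ cB a U₀) Y)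
        (flat115 Y)
      = pair27 (LinearMap.toContinuousLinearMap (Matrix.traceLinearMap (Fin 2) ℂ ℂ))
          (currentCLM frobEquiv (fun _ : Bond 3 (periodsT3 F K) × Fin 3 => K - n) (nabla115 (((F.L : ℝ)⁻¹) ^ (K - n)) (bgOfCfg F K U₀)) (DeltaPiSlot F n K h c₀ cB a U₀) Y)
          (flat115 Y)
        - 2 * pair27 (LinearMap.toContinuousLinearMap (Matrix.traceLinearMap (Fin 2) ℂ ℂ))
          (Jcur (bgOfCfg F K U₀) : NegSize (F.L : ℝ) (((F.L : ℝ)⁻¹) ^ (K - n)) (fun _ : Bond 3 (periodsT3 F K) => K - n) 3 (Matrix (Fin 2) (Fin 2) ℂ))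
          (flat115 (H1f F n K h c₀ cB a (DeltaPiSlot F n K h c₀ cB a) U₀
            (quadPart (fun A' : Space115 (F.L : ℝ) (((F.L : ℝ)⁻¹) ^ (K - n)) (fun _ : Bond 3 (periodsT3 F K) => K - n)
                (fun _ : Bond 3 (periodsT3 F K) × Fin 3 => K - n) (nabla115 (((F.L : ℝ)⁻¹) ^ (K - n)) (bgOfCfg F K U₀)) =>
                  (-Complex.I) • CmapTwS F n K h U₀ (((((eta F n K : ℝ) : ℂ)) * Complex.I) • fun b : PBond (F.P K) 0 => JetSup.equiv _ _ _ A' (bondEquiv F K b))) Y))) := by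
  have hη : ((((F.L : ℝ)⁻¹) ^ (K - n) : ℝ) : ℂ) = (((eta F n K : ℝ) : ℂ)) := rfl
  have hη0 : (((eta F n K : ℝ) : ℂ)) ≠ 0 := Complex.ofReal_ne_zero.2 (eta_pos F n K).ne'
  have hc : (c₀ : ℂ) ≠ 0 := Complex.ofReal_ne_zero.2 (Fact.out : 0 < c₀).ne'
  have hI : Complex.I * Complex.I = -1 := Complex.I_mul_I
  have hstar : star (fun b : PBond (F.P K) 0 => JetSup.equiv _ _ _ Y (bondEquiv F K b)) = fun b : PBond (F.P K) 0 => JetSup.equiv _ _ _ Y (bondEquiv F K b) := funext hR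
  have hv : RS F n K h c₀ cB U₀ (DstarL2 F n K c₀ U₀ (toL2 F K c₀ (fun b : PBond (F.P K) 0 => JetSup.equiv _ _ _ Y (bondEquiv F K b)))) = 0 := (isLandauPrintS_iff_RS U₀ _).1 hL
  -- the quadratic letter `C̃⁽²⁾(Y) = (Iη²∕2)•avgHess ιY ιY` and the `J`-pairing of its `H̃`-image: `= η·t_J[ιY, ιY]`
  have hT' : actionGrad F K U₀ (H46 F n K h c₀ cB a U₀ (avgHess F n K h U₀ (fun b : PBond (F.P K) 0 => JetSup.equiv _ _ _ Y (bondEquiv F K b))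
      (fun b : PBond (F.P K) 0 => JetSup.equiv _ _ _ Y (bondEquiv F K b))))
      = -tjForm F n K h c₀ cB a U₀ (fun b : PBond (F.P K) 0 => JetSup.equiv _ _ _ Y (bondEquiv F K b)) (fun b : PBond (F.P K) 0 => JetSup.equiv _ _ _ Y (bondEquiv F K b)) := by
    rw [tjForm_apply, neg_neg]
  rw [quadPart_Ctilde_eq (h := h) hε₀ he hWe hWε U₀ hreg Y]
  have hJ := pair27_Jcur_iota_H1f_eq (h := h) (c₀ := c₀) (cB := cB) (a := a) U₀ (((Complex.I * (((eta F n K : ℝ) : ℂ)) ^ 2) / 2) •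
    avgHess F n K h U₀ (fun b : PBond (F.P K) 0 => JetSup.equiv _ _ _ Y (bondEquiv F K b)) (fun b : PBond (F.P K) 0 => JetSup.equiv _ _ _ Y (bondEquiv F K b)))
  have hJ2 : 2 * Complex.I * actionGrad F K U₀ (H46 F n K h c₀ cB a U₀ (Complex.I • (((Complex.I * (((eta F n K : ℝ) : ℂ)) ^ 2) / 2) •
      avgHess F n K h U₀ (fun b : PBond (F.P K) 0 => JetSup.equiv _ _ _ Y (bondEquiv F K b)) (fun b : PBond (F.P K) 0 => JetSup.equiv _ _ _ Y (bondEquiv F K b)))))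
      = 2 * Complex.I * ((Complex.I * ((Complex.I * (((eta F n K : ℝ) : ℂ)) ^ 2) / 2)) *
          -tjForm F n K h c₀ cB a U₀ (fun b : PBond (F.P K) 0 => JetSup.equiv _ _ _ Y (bondEquiv F K b)) (fun b : PBond (F.P K) 0 => JetSup.equiv _ _ _ Y (bondEquiv F K b))) := by
    rw [smul_smul, map_smul, map_smul, smul_eq_mul, hT']
  have hP2 : pair27 (LinearMap.toContinuousLinearMap (Matrix.traceLinearMap (Fin 2) ℂ ℂ))
      (Jcur (bgOfCfg F K U₀) : NegSize (F.L : ℝ) (((F.L : ℝ)⁻¹) ^ (K - n)) (fun _ : Bond 3 (periodsT3 F K) => K - n) 3 (Matrix (Fin 2) (Fin 2) ℂ))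
      (flat115 (H1f F n K h c₀ cB a (DeltaPiSlot F n K h c₀ cB a) U₀ ((((Complex.I * (((eta F n K : ℝ) : ℂ)) ^ 2) / 2) •
        avgHess F n K h U₀ (fun b : PBond (F.P K) 0 => JetSup.equiv _ _ _ Y (bondEquiv F K b)) (fun b : PBond (F.P K) 0 => JetSup.equiv _ _ _ Y (bondEquiv F K b))))))
      = (((eta F n K : ℝ) : ℂ)) * tjForm F n K h c₀ cB a U₀ (fun b : PBond (F.P K) 0 => JetSup.equiv _ _ _ Y (bondEquiv F K b)) (fun b : PBond (F.P K) 0 => JetSup.equiv _ _ _ Y (bondEquiv F K b)) := by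
    have hκ : (((eta F n K : ℝ) : ℂ)) * Complex.I ≠ 0 := mul_ne_zero hη0 Complex.I_ne_zero
    refine mul_left_cancel₀ hκ ?_
    rw [hJ, hJ2]
    linear_combination (-((((eta F n K : ℝ) : ℂ)) ^ 2) * Complex.I *
      tjForm F n K h c₀ cB a U₀ (fun b : PBond (F.P K) 0 => JetSup.equiv _ _ _ Y (bondEquiv F K b)) (fun b : PBond (F.P K) 0 => JetSup.equiv _ _ _ Y (bondEquiv F K b))) * hI
  rw [hP2]
  -- the two Hessian pairings in `L²` letters; `⟪v, Δ₁v⟫ − ⟪v, Δ_πv⟫ = tjSesq v v = (−2c₀∕η²)·t_J[ιY, ιY]`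
  have hS : tjSesq F n K h c₀ cB a U₀ (toL2 F K c₀ (fun b : PBond (F.P K) 0 => JetSup.equiv _ _ _ Y (bondEquiv F K b)))
      (toL2 F K c₀ (fun b : PBond (F.P K) 0 => JetSup.equiv _ _ _ Y (bondEquiv F K b)))
      = ((-(2 * (c₀ : ℂ)) / (((eta F n K : ℝ) : ℂ)) ^ 2)) *
          tjForm F n K h c₀ cB a U₀ (fun b : PBond (F.P K) 0 => JetSup.equiv _ _ _ Y (bondEquiv F K b)) (fun b : PBond (F.P K) 0 => JetSup.equiv _ _ _ Y (bondEquiv F K b)) := by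
    rw [tjSesq_apply, LinearEquiv.symm_apply_apply, hstar]
  have h1 := inner_DeltaOneJ_sub_inner_DeltaPi_of_landau (a := a) hε₀ he hWe hWε U₀ hreg hv
  rw [hS] at h1
  simp only [pair27_eq_inner_toL2 (c₀ := c₀), toL2_currentCLM, flat115_apply, hstar, hη]
  rw [eq_add_of_sub_eq h1]  -- `⟪v, Δ₁v⟫ = (−2c₀∕η²)·t_J + ⟪v, Δ_πv⟫`
  field_simp
  ring

/-- ★★ **THE MEMBER TEXT OF lit `hasDerivAt_actionZ_chartRay_real`'s HYPOTHESIS `h79`** at `U₀ ∈ 𝔘_k(ε₀)` in the windows, with `P Y := IsLandauPrintS … U₀ (ιY) ∧ ∀ b, star (ιY b) = ιY b`,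
`Δ₁ := currentCLM … (DeltaOneJ … U₀)`, `Δπ := currentCLM … (DeltaPiSlot … U₀)`, `H := H1f …Δ_π… U₀`, `C := C̃`, `J := Jcur (bgOfCfg F K U₀)`.
[cite: Balaban1985Variational, (78)–(79) p.290, (76)–(77) p.289] -/
theorem h79_member_DeltaOneJ {ε₀ e : ℝ} (hε₀ : 0 < ε₀) (he : 0 < e) (hWe : 10 ^ 9 * (F.L : ℝ) ^ 2 * e ≤ 1) (hWε : 10 ^ 12 * (F.L : ℝ) ^ 3 * ε₀ ≤ 1)
    (U₀ : GaugeField (F.P K) 0 (Matrix.specialUnitaryGroup (Fin 2) ℂ)) (hreg : RegPr F n K ε₀ U₀) :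
    ∀ Y : Space115 (F.L : ℝ) (((F.L : ℝ)⁻¹) ^ (K - n)) (fun _ : Bond 3 (periodsT3 F K) => K - n) (fun _ : Bond 3 (periodsT3 F K) × Fin 3 => K - n)
        (nabla115 (((F.L : ℝ)⁻¹) ^ (K - n)) (bgOfCfg F K U₀)),
      (IsLandauPrintS F n K h c₀ cB U₀ (fun b : PBond (F.P K) 0 => JetSup.equiv _ _ _ Y (bondEquiv F K b))
          ∧ ∀ b : PBond (F.P K) 0, star (JetSup.equiv _ _ _ Y (bondEquiv F K b)) = JetSup.equiv _ _ _ Y (bondEquiv F K b)) →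
        pair27 (LinearMap.toContinuousLinearMap (Matrix.traceLinearMap (Fin 2) ℂ ℂ))
            (currentCLM frobEquiv (fun _ : Bond 3 (periodsT3 F K) × Fin 3 => K - n) (nabla115 (((F.L : ℝ)⁻¹) ^ (K - n)) (bgOfCfg F K U₀)) (DeltaOneJ F n K h c₀ cB a U₀) Y)
            (flat115 Y)
          = pair27 (LinearMap.toContinuousLinearMap (Matrix.traceLinearMap (Fin 2) ℂ ℂ))
              (currentCLM frobEquiv (fun _ : Bond 3 (periodsT3 F K) × Fin 3 => K - n) (nabla115 (((F.L : ℝ)⁻¹) ^ (K - n)) (bgOfCfg F K U₀)) (DeltaPiSlot F n K h c₀ cB a U₀) Y)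
              (flat115 Y)
            - 2 * pair27 (LinearMap.toContinuousLinearMap (Matrix.traceLinearMap (Fin 2) ℂ ℂ))
              (Jcur (bgOfCfg F K U₀) : NegSize (F.L : ℝ) (((F.L : ℝ)⁻¹) ^ (K - n)) (fun _ : Bond 3 (periodsT3 F K) => K - n) 3 (Matrix (Fin 2) (Fin 2) ℂ))
              (flat115 (H1f F n K h c₀ cB a (DeltaPiSlot F n K h c₀ cB a) U₀
                (quadPart (fun A' : Space115 (F.L : ℝ) (((F.L : ℝ)⁻¹) ^ (K - n)) (fun _ : Bond 3 (periodsT3 F K) => K - n)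
                    (fun _ : Bond 3 (periodsT3 F K) × Fin 3 => K - n) (nabla115 (((F.L : ℝ)⁻¹) ^ (K - n)) (bgOfCfg F K U₀)) =>
                      (-Complex.I) • CmapTwS F n K h U₀ (((((eta F n K : ℝ) : ℂ)) * Complex.I) • fun b : PBond (F.P K) 0 => JetSup.equiv _ _ _ A' (bondEquiv F K b))) Y))) :=
  fun Y hP => pair27_DeltaOneJ_eq_of_landau hε₀ he hWe hWε U₀ hreg Y hP.2 hP.1

end Summit.QuantumFields.YangMills.Theorems.Prop7Row79AtMember

end
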